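import Summits.ABC.StewartYu.DescentStepQ
import HarnessLib

/-!
# Cell abc-stewartyu, WP-Y provider B (iv-a): the algebraic half of the descent, UNBUNDLED

`Summits/ABC/StewartYu/DescentStepQParts.lean` — cell `abc-stewartyu` (HOME
`run/shared/lean/pub/abc-stewartyu/`, seat p3; cruxes `W80OneModFour` stmt-ABC-19487 /
`W80ThreeModFour` stmt-ABC-19485, design memo HOME/p3/memo-05 §4). p3-g0's `SetupQ.descent_algebra`
(`DescentStepQ.lean`) takes the BUNDLED invariant `SetupQ.Inv` at level `J`, although its proof uses only
the support, the size bound, a pivot `u₀` with `p(u₀) ≠ 0` and the vanishing of the class sums — never the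
level-`J` relations. The `p ≡ 1 (mod 4)` half step (provider B) applies the descent to the SIGN-TWISTED
RESTRICTION of the coefficient vector to one exact sub-class, for which the level-`J` relations are not
available; this file records the unbundled form, with the pivot explicit and the new vector
`p'(v) = p(ε + 2v)` ((ε, ε_θ) = residues of `u₀`) named in the conclusion (so the caller can update the
class value). Proof VERBATIM p3-g0's. [folklore] algebra; no named fact.
-/

noncomputable section

open Finset
open Literature.NumberTheory.Transcendental
open Literature.NumberTheory.Transcendental.CW77.Setup (Idx Tau tauNorm)

namespace Summit.ABC.StewartYu

namespace SetupQPM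

open SetupQ
open Literature.NumberTheory.Transcendental.CW77 (sum_mul_prod_pow_eq_zero_of_shift)

variable (Q : SetupQ) {h Lb : ℕ}

/-- **The algebraic half of the descent, unbundled** (verbatim p3's `SetupQ.descent_algebra`, with the
support/bound hypotheses instead of the bundled invariant — the level-`J` relations are NOT used — and
the pivot `u₀` explicit; the new vector is `p'(v) = p(ε + 2v)` for the residues `(ε, ε_θ)` of `u₀`).
[folklore] -/
theorem inv_succ_of_parts {J₀ J : ℕ} {L : Fin Q.d → ℕ} {Lθ S₀ T : ℕ} {P : ℤ}
    {p : Idx Q.d h Lb → ℤ} (u₀ : Idx Q.d h Lb) (hu₀ : p u₀ ≠ 0)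
    (hsupp : ∀ u, p u ≠ 0 → u ∈ Q.flat.box (h := h) (Lb := Lb) L Lθ J)
    (hbound : ∀ u, |p u| ≤ P)
    (half : ∀ s, s < 2 ^ (J + 1) * S₀ → Odd s → ∀ τ : Tau Q.d, tauNorm τ < T / 2 ^ (J + 1) →
      Q.classVec J₀ J (Q.flat.box (h := h) (Lb := Lb) L Lθ J) p τ s = 0) :
    Q.Inv J₀ L Lθ S₀ T P (J + 1)
      (fun v => p (Q.flat.reidx (fun j => u₀.2.1 j % 2) (u₀.2.2 % 2) v)) := by
  classical
  set ε : Fin Q.d → ℕ := fun j => u₀.2.1 j % 2 with hεdef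
  set εθ : ℕ := u₀.2.2 % 2 with hεθdef
  have hε : ∀ j, ε j ≤ 1 := fun j => by simp only [hεdef]; omega
  have hεθ : εθ ≤ 1 := by simp only [hεθdef]; omega
  set p' : Idx Q.d h Lb → ℤ := fun v => p (Q.flat.reidx ε εθ v) with hp'
  set boxJ := Q.flat.box (h := h) (Lb := Lb) L Lθ J with hboxJ
  set boxJ1 := Q.flat.box (h := h) (Lb := Lb) L Lθ (J + 1) with hboxJ1
  refine ⟨?_, ?_, ?_, ?_⟩
  · intro v hv
    exact Q.flat.mem_box_succ_of_reidx (hsupp _ hv)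
  · refine ⟨Q.flat.halve u₀, ?_⟩
    show p (Q.flat.reidx ε εθ (Q.flat.halve u₀)) ≠ 0
    rw [Q.flat.reidx_halve u₀ (fun j => rfl) rfl]
    exact hu₀
  · intro v; exact hbound _
  · intro s hs hodd τ hτ
    have hcv : ∀ τ' : Fin Q.d → ℕ, τ.1 + ∑ j, τ' j < T / 2 ^ (J + 1) →
        Q.classVec J₀ J boxJ p (τ.1, τ') s (Q.flat.Tpat ε εθ) = 0 := by
      intro τ' hτ'
      have h0 := half s hs hodd (τ.1, τ') (by unfold tauNorm; exact hτ')
      exact congrFun h0 _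
    set Vs := boxJ1.filter fun v => Q.flat.reidx ε εθ v ∈ boxJ with hVs
    set W : Idx Q.d h Lb → ℚ := fun v => (p' v : ℚ) * (Q.flat.qΔ J₀ (J + 1) v τ.1 s * Q.qE v s) with hW
    have hshift : ∀ τ' : Fin Q.d → ℕ, ∑ j, τ' j < T / 2 ^ (J + 1) - τ.1 →
        ∑ v ∈ Vs, W v * ∏ j, (Q.flat.γ v j + Q.flat.cγ ε εθ j) ^ τ' j = 0 := by
      intro τ' hτ'
      have h1 := hcv τ' (by omega)
      unfold classVec at h1
      rw [Q.flat.sum_class_eq_sum_reidx hodd hε hεθ L Lθ J] at h1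
      simp_rw [Q.rHalf_reidx] at h1
      have hK : (2 : ℚ) ^ (∑ j, τ' j) * Q.Kfac ε εθ s ≠ 0 :=
        mul_ne_zero (pow_ne_zero _ two_ne_zero) (Q.Kfac_ne ε εθ s)
      have h2 : ∑ v ∈ Vs, (p (Q.flat.reidx ε εθ v) : ℚ) *
          ((2 : ℚ) ^ (∑ j, τ' j) * Q.Kfac ε εθ s * ((Q.flat.qΔ J₀ (J + 1) v τ.1 s * Q.qE v s) *
            ∏ j, (Q.flat.γ v j + Q.flat.cγ ε εθ j) ^ τ' j)) =
          ((2 : ℚ) ^ (∑ j, τ' j) * Q.Kfac ε εθ s) *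
            ∑ v ∈ Vs, W v * ∏ j, (Q.flat.γ v j + Q.flat.cγ ε εθ j) ^ τ' j := by
        rw [mul_sum]
        refine sum_congr rfl fun v _ => ?_
        simp only [hW, hp']; ring
      rw [h2] at h1
      exact (mul_eq_zero.mp h1).resolve_left hK
    have hrel := sum_mul_prod_pow_eq_zero_of_shift (d := Q.d) Vs W (fun v j => Q.flat.γ v j)
      (Q.flat.cγ ε εθ) _ hshift τ.2 (by unfold tauNorm at hτ; omega)
    have hcore : Q.coreSum J₀ (J + 1) boxJ1 p' τ s = ∑ v ∈ Vs, W v * ∏ j, Q.flat.γ v j ^ τ.2 j := by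
      unfold coreSum
      rw [hVs, sum_filter]
      refine sum_congr rfl fun v hv => ?_
      by_cases hvb : Q.flat.reidx ε εθ v ∈ boxJ
      · rw [if_pos hvb]
        unfold qTerm CW77.Setup.qA
        simp only [hW]; ring
      · rw [if_neg hvb]
        have : p' v = 0 := by
          simp only [hp']
          by_contra hne
          exact hvb (hsupp _ hne)
        rw [this]; simp
    show Q.coreSum J₀ (J + 1) boxJ1 p' τ s = 0
    rw [hcore]; exact hrel

end SetupQPM

end Summit.ABC.StewartYu

end
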